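import Mathlib
import Literature.NumberTheory.Transcendental.RoyCriterion

/-!
# Sketch — crux-ideate stmt-Schanuel-0078 (RoyThesis), ideator 3, round 1

First lemmas of idea card `ax-transversal-xi-fields` (elaboration check only; nothing here is
a route item).  Crux: `∀ n, Literature.NumberTheory.Transcendental.RoyCriterion n`.
-/

noncomputable section

open Complex

namespace Summit.Schanuel.Schanuel.Cruxes.RoyThesis.AxTransversalSketch

open Literature.NumberTheory.Transcendental

/-- The ℚ-locus (ℚ-Zariski closure) of a point `θ ∈ ℂ^ι`: common zeros of all rational
polynomials vanishing at `θ`. For `θ = (y, e^y)` with `trdeg ℚ(θ) = l - 1` this is the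
counterexample variety `V` of the card. -/
def locusQ {ι : Type*} (θ : ι → ℂ) : Set (ι → ℂ) :=
  {p | ∀ F : MvPolynomial ι ℚ, MvPolynomial.aeval θ F = 0 → MvPolynomial.aeval p F = 0}

/-- The graph point `(y, e^y) ∈ ℂ^l × ℂ^l`. -/
def graphPt {l : ℕ} (y : Fin l → ℂ) : Fin l ⊕ Fin l → ℂ :=
  Sum.elim y (cexp ∘ y)

/-- An analytic, non-constant germ of curve `t ↦ c t` in `ℂ^l` through `y` whose exponential
graph stays inside the ℚ-locus of `(y, e^y)` — the DEGENERATE BRANCH of the card's dichotomy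
(equivalently: `T_θ V ∩ T_θ E ≠ 0` propagated by genericity + Frobenius). -/
def HasGraphCurveInLocus {l : ℕ} (y : Fin l → ℂ) : Prop :=
  ∃ c : ℂ → Fin l → ℂ, (∀ i, AnalyticAt ℂ (fun t => c t i) 0) ∧ c 0 = y ∧
    (¬ ∀ᶠ t in nhds (0 : ℂ), c t = y) ∧
    ∀ᶠ t in nhds (0 : ℂ), graphPt (c t) ∈ locusQ (graphPt y)

/-- FIRST LEMMA (degenerate branch dies by Ax–Schanuel + lower ranks): if the ℚ-locus of
`θ = (y, e^y)` contains a non-constant analytic germ of the exponential graph through `θ`, then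
Schanuel holds at `y`, given Schanuel in all ranks `< l`.  Intended proof: Ax 1971 Thm 3 with one
derivation `d/dt` on the germ (tree: `ax_schanuel`, conditional `ax_schanuel_of_rosenlicht`),
applied to the moving part of `c`, plus `SchanuelRank ρ` for the ℚ-span `R` of the constant
combinations (`2 ≤ ρ ≤ l-1`, or `ρ ≤ 1` handled by Ax alone). -/
def AxBranch (l : ℕ) : Prop :=
  ∀ y : Fin l → ℂ, LinearIndependent ℚ y → (∀ r, r < l → SchanuelRank r) →
    HasGraphCurveInLocus y →
      (l : Cardinal) ≤ Algebra.trdeg ℚ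
        ↥(IntermediateField.adjoin ℚ (Set.range y ∪ Set.range (cexp ∘ y)))

/-- GENERIC BRANCH (the open stub the card isolates): no graph curve in the locus, i.e. the
counterexample variety is transversal to the exponential graph at `θ`; here the card's rational
vector fields `Ξ_m` on `V` intertwine Roy's `D = ∂₀ + X₁∂₁` under `π_m`. -/
def GenericBranch (l : ℕ) : Prop :=
  ∀ y : Fin l → ℂ, LinearIndependent ℚ y → (∀ r, r < l → SchanuelRank r) →
    ¬ HasGraphCurveInLocus y →
      (l : Cardinal) ≤ Algebra.trdeg ℚ
        ↥(IntermediateField.adjoin ℚ (Set.range y ∪ Set.range (cexp ∘ y)))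

/-- The dichotomy composes to Schanuel rank by rank (strong induction), hence to the crux via
`Roy2001_iff` (tree theorem `Roy2001_iff_holds`). [folklore] -/
theorem schanuelRank_of_branches (hA : ∀ l, AxBranch l) (hG : ∀ l, GenericBranch l) :
    ∀ l, SchanuelRank l := by
  intro l
  induction l using Nat.strong_induction_on with
  | _ l ih =>
    intro y hy
    by_cases hc : HasGraphCurveInLocus y
    · exact hA l y hy (fun r hr => ih r hr) hc
    · exact hG l y hy (fun r hr => ih r hr) hc

/-- … and to the crux `RoyThesis = ∀ n, RoyCriterion n`, given Roy's equivalence (proved in tree as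
`Roy2001_iff_holds`; taken here as a hypothesis to keep the sketch's imports light). [folklore] -/
theorem royThesis_of_branches (hIff : Roy2001_iff) (hA : ∀ l, AxBranch l)
    (hG : ∀ l, GenericBranch l) : ∀ n, RoyCriterion n :=
  fun n => (hIff n).mpr (schanuelRank_of_branches hA hG n)

/-- Rank-2 arithmetic face of the card's invariant `κ(θ) ∉ ℙ¹(ℚ)` ("the Ax slope of a rank-2
counterexample is irrational"): for `n ≠ 0` the pair `(n·y, e^{n·y})` is never algebraic — this is
Hermite–Lindemann applied to `n·y ≠ 0` (tree: `transcendental_exp`). Stated, not proved here. -/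
def NoAlgebraicTranslate (l : ℕ) : Prop :=
  ∀ y : Fin l → ℂ, LinearIndependent ℚ y → ∀ n : Fin l → ℤ, n ≠ 0 →
    ¬ (IsAlgebraic ℚ (∑ j, (n j : ℂ) * y j) ∧ IsAlgebraic ℚ (cexp (∑ j, (n j : ℂ) * y j)))

end Summit.Schanuel.Schanuel.Cruxes.RoyThesis.AxTransversalSketch

end
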